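import Literature.NumberTheory.Sieve.MoebiusShiftedPrimesMajorArcsPieces
import Literature.NumberTheory.Sieve.MoebiusShiftedPrimesMeanSquare
import Literature.NumberTheory.Sieve.MoebiusShiftedPrimesDirichletMeanValue33
import Literature.NumberTheory.Sieve.MoebiusShiftedPrimesPrimeCharacterSum
import HarnessLib

/-!
# Möbius on shifted primes — Proposition 2.3 of Lichtman 2020 (printed typical set, regime
# `H ≤ exp((log X)^{2/3})`) from Lemma 4.5, i.e. from the Vinogradov–Korobov input

Topic `Literature/NumberTheory/Sieve`; the "Proofs" companion of `MoebiusShiftedPrimesArcs.lean`,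
whose named fact `Literature.NumberTheory.Sieve.Lichtman2020_keyFourierEstimateLiouville'` renders
Proposition 2.3 of J. D. Lichtman, *Averages of the Möbius function on shifted primes*, Q. J. Math. 73
(2022) 729–757, doi:10.1093/qmath/haab054, arXiv:2009.08969v2 [Lichtman2020], for the PRINTED typical
set `S = S(X,A,δ)` of (2.3)–(2.4) (`P₁ = (log X)^{33A}`) in the regime `H ≤ exp((log X)^{2/3})` of
p. 8.  Everything in this file is PROVED; it introduces no definition and no named fact.  Page numbers
refer to the held copy `paper:arxiv-2009.08969`.

## Result

* `Lichtman2020_keyFourierEstimateLiouville'_of_primeCharacterSum :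
    Lichtman2020_primeCharacterSum → Lichtman2020_keyFourierEstimateLiouville'` — the fact from ONE
  named fact of the paper's §4, Lemma 4.5 (the Vinogradov–Korobov bound for prime character sums,
  `MoebiusShiftedPrimesTypical.lean`), every other input being proved in the tree;
* `Lichtman2020_keyFourierEstimateLiouville'_of_khale` — hence from Khale's explicit
  Vinogradov–Korobov zero-free region for Dirichlet `L`-functions
  (`Literature.NumberTheory.LFunctions.Khale2024_zeroFreeRegion`, through the tree's
  `Lichtman2020.PrimeCharSum.Lichtman2020_primeCharacterSum_of_khale`), the only printed theorem of the
  whole deduction that is not proved in the tree;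
* `Lichtman2020_keyFourierEstimate_of_primeCharacterSum'`, `Lichtman2020_keyFourierEstimate_of_khale'` —
  the same for Theorem 2.2 with the printed set (`Lichtman2020_keyFourierEstimate`, regime
  `H ≤ exp((log X)^{2/3})`), through the tree's `Lichtman2020_keyFourierEstimate_of_liouville'`;
* `Lichtman2020_keyFourierEstimateLiouville'_of_vk`, `Lichtman2020_keyFourierEstimate_of_vk'` — the same
  two statements from ANY Vinogradov–Korobov region `HasVKZeroFreeRegion c T₀` (`c > 0`, any `T₀`;
  the inexplicit interface of `VinogradovKorobovDirichlet.lean`, of which Khale's theorem is the case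
  `c = 1/61.5`, `T₀ = 10`), through `Lichtman2020.PrimeCharSum.Lichtman2020_primeCharacterSum_of_vk`.

So the fact is discharged up to the Vinogradov–Korobov zero-free region: an unconditional
`Lichtman2020_keyFourierEstimateLiouville'_holds` needs a Vinogradov–Korobov region for Dirichlet
`L`-functions to be proved in the tree — Khale's explicit `Khale2024_zeroFreeRegion`, or any
inexplicit `HasVKZeroFreeRegion c T₀` with `c > 0` (Vinogradov's method with unspecified constants) —
or Lemma 4.5 directly; nothing else.

## The route (printed set, re-balanced parameters)

`MoebiusShiftedPrimesTypical.lean` records that the printed proof of Proposition 5.1 does not give the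
printed saving `(log X)^{-11A}` at `P₁ = (log X)^{33A}` (the tree's main chain therefore runs along
corrected sets `S_c`, `c ≥ 100`).  For the printed set the paper's method still proves Proposition 2.3
once its parameters are re-balanced, in three proved steps:
1. `Lichtman2020.dirichletMeanValue33` (`MoebiusShiftedPrimesDirichletMeanValue33.lean`): Proposition 5.1
   for `S_c`, `c ≥ 33`, with saving `(log X)^{-3A}` and lower limit `(log X)^{6A}`, from Lemma 4.5;
2. `Lichtman2020.liouvilleMeanSquareWeak_of_primeCharacterSum` (this file): the WEAK Proposition 3.4
   — `∫_Y^{2Y} |∑_{x ≤ m ≤ x+h, m ∈ S} λ(m)χ(m)|² dx ≪ h²Y/(log X)^{12A/5}` for `q ≤ (log X)^A`,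
   `χ (mod q)`, `h ∈ [H/(log X)^{21A/5}, H]`, `Y ∈ [X/(log X)^{6A}, X]` — by the printed "Proof of
   Proposition 3.4 from Proposition 5.1" (p. 14): Lemma 4.8 (PROVED in the tree,
   `Lichtman2020_liouvilleCharacterSifted_holds`) for the long windows, the Parseval bound Lemma 4.6 and
   Lemma 4.1 through the tree's skeleton `Lichtman2020.meanSquare_le_of_pieces_trunc` with
   `T₀ = (log X)^{6A}`, `h₂ = Y/T₀³`, and step 1 for `χ`, `χ̄`; numerics: `Q₁/h ≤ (log X)^{A/5}` so
   `(Q₁/h + 1)(log X)^{-3A} ≤ 2 (log X)^{-14A/5}`, `2000/T₀² + 2000/h + 4/Y ≤ 4004 (log X)^{-12A/5}`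
   (`h ≥ H/(log X)^{21A/5} ≥ (log X)^{12A/5}`, `Y ≥ X/(log X)^{6A}`);
3. `Lichtman2020_keyFourierEstimateLiouville'_of_meanSquareWeak` (`MoebiusShiftedPrimesMajorArcsPieces.lean`):
   the major arcs by pieces of `≍ 1/|θ|` integers need only the weak Proposition 3.4, and the minor
   arcs are the tree's proved Proposition 3.1.

## Faithfulness notes

* The statement discharged (conditionally) is the tree's rendering of Proposition 2.3 in the regime,
  unchanged.  The intermediate "weak Proposition 3.4" is not a printed statement; it is a theorem with
  explicit hypotheses, not a named fact.
* Lemma 4.8 is applied with `(2A, 71A)` for `(A, K)` as in the tree's proof of Proposition 3.4 along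
  `S_c` (`Lichtman2020_liouvilleMeanSquareWith_of_dirichletMeanValueWith`), whose growth lemmas are
  reused (`h_le_h₂`, `T₀_le_U`, `sqrt_le_U'`, `lemma48_at_points`, `norm_longWindow_le`).

## Sources

* J. D. Lichtman, arXiv:2009.08969v2: Proposition 2.3 p. 8; §3 p. 9; "Proof of Proposition 3.4 from
  Proposition 5.1", (5.1)–(5.6), p. 14; Lemmas 4.1, 4.5, 4.6, 4.8, pp. 11–13 [Lichtman2020].
* T. Khale, Q. J. Math. 75 (2024) 299–332, Theorem 1.1 [Khale2024].
-/

noncomputable section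

open Filter Asymptotics Finset MeasureTheory
open scoped Topology

namespace Literature.NumberTheory.Sieve

namespace Lichtman2020

open ArithmeticFunction

/-! ### Numerics of the weak Proposition 3.4 (`T₀ = ℓ^{6A}`, saving `ℓ^{12A/5}`) -/

/-- (n1) `2000/T₀² ≤ 2000 ℓ^{-12A/5}` for `T₀ = ℓ^{6A}`. [folklore] -/
theorem numericsW_T₀ {ℓ A : ℝ} (hℓ : 1 ≤ ℓ) (hA : 0 ≤ A) :
    2000 / (ℓ ^ (6 * A)) ^ 2 ≤ 2000 * (1 / ℓ ^ (12 / 5 * A)) := by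
  have hℓ0 : 0 < ℓ := by linarith
  have e : (ℓ ^ (6 * A)) ^ 2 = ℓ ^ (12 * A) := by
    rw [← Real.rpow_natCast, ← Real.rpow_mul hℓ0.le]; ring_nf
  rw [e, mul_one_div]
  exact div_le_div_of_nonneg_left (by norm_num) (Real.rpow_pos_of_pos hℓ0 _)
    (Real.rpow_le_rpow_of_exponent_le hℓ (by nlinarith))

/-- (n2) `36 C₅ (Q₁/h + 1) ℓ^{-3A} ≤ 72 C₅ ℓ^{-12A/5}` for `Q₁ = H/ℓ^{4A}`, `h ≥ H/ℓ^{21A/5}`. [folklore] -/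
theorem numericsW_main {ℓ A C₅ Hx h : ℝ} (hℓ : 1 ≤ ℓ) (hA : 0 ≤ A) (hC₅ : 0 ≤ C₅) (hHx : 0 < Hx)
    (hh : Hx / ℓ ^ (21 / 5 * A) ≤ h) :
    36 * C₅ * (Hx / ℓ ^ (4 * A) / h + 1) * (1 / ℓ ^ (3 * A)) ≤ 72 * C₅ * (1 / ℓ ^ (12 / 5 * A)) := by
  have hℓ0 : 0 < ℓ := by linarith
  have h21 : 0 < ℓ ^ (21 / 5 * A) := Real.rpow_pos_of_pos hℓ0 _
  have h4 : 0 < ℓ ^ (4 * A) := Real.rpow_pos_of_pos hℓ0 _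
  have hh0 : 0 < h := lt_of_lt_of_le (by positivity) hh
  -- `Q₁/h ≤ ℓ^{A/5}`
  have hQ : Hx / ℓ ^ (4 * A) / h ≤ ℓ ^ (A / 5) := by
    rw [div_div, div_le_iff₀ (by positivity)]
    have e : ℓ ^ (21 / 5 * A) = ℓ ^ (A / 5) * ℓ ^ (4 * A) := by
      rw [← Real.rpow_add hℓ0]; ring_nf
    rw [div_le_iff₀ h21, e] at hh
    nlinarith
  have hA5 : 1 ≤ ℓ ^ (A / 5) := Real.one_le_rpow hℓ (by positivity)
  have h3 : 0 < ℓ ^ (3 * A) := Real.rpow_pos_of_pos hℓ0 _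
  have e : ℓ ^ (3 * A) = ℓ ^ (A / 5) * ℓ ^ (14 / 5 * A) := by
    rw [← Real.rpow_add hℓ0]; ring_nf
  have h14 : ℓ ^ (12 / 5 * A) ≤ ℓ ^ (14 / 5 * A) := Real.rpow_le_rpow_of_exponent_le hℓ (by nlinarith)
  have h12 : 0 < ℓ ^ (12 / 5 * A) := Real.rpow_pos_of_pos hℓ0 _
  calc 36 * C₅ * (Hx / ℓ ^ (4 * A) / h + 1) * (1 / ℓ ^ (3 * A))
      ≤ 36 * C₅ * (ℓ ^ (A / 5) + ℓ ^ (A / 5)) * (1 / ℓ ^ (3 * A)) := by gcongr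
    _ = 72 * C₅ * (ℓ ^ (A / 5) / ℓ ^ (3 * A)) := by ring
    _ = 72 * C₅ * (1 / ℓ ^ (14 / 5 * A)) := by
        rw [e, ← div_div, div_self (by positivity)]
    _ ≤ 72 * C₅ * (1 / ℓ ^ (12 / 5 * A)) := by
        refine mul_le_mul_of_nonneg_left ?_ (by positivity)
        exact one_div_le_one_div_of_le h12 h14

/-- (n3) `2000/h ≤ 2000 ℓ^{-12A/5}` for `h ≥ H/ℓ^{21A/5}`, `H ≥ ℓ^{33A/5}`. [folklore] -/
theorem numericsW_h {ℓ A Hx h : ℝ} (hℓ : 1 ≤ ℓ) (hHx : ℓ ^ (33 / 5 * A) ≤ Hx)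
    (hh : Hx / ℓ ^ (21 / 5 * A) ≤ h) : 2000 / h ≤ 2000 * (1 / ℓ ^ (12 / 5 * A)) := by
  have hℓ0 : 0 < ℓ := by linarith
  have h33 : 0 < ℓ ^ (33 / 5 * A) := Real.rpow_pos_of_pos hℓ0 _
  have h21 : 0 < ℓ ^ (21 / 5 * A) := Real.rpow_pos_of_pos hℓ0 _
  have hHx0 : 0 < Hx := h33.trans_le hHx
  have hh0 : 0 < h := lt_of_lt_of_le (by positivity) hh
  have e : ℓ ^ (33 / 5 * A) = ℓ ^ (12 / 5 * A) * ℓ ^ (21 / 5 * A) := by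
    rw [← Real.rpow_add hℓ0]; ring_nf
  have h10 : ℓ ^ (12 / 5 * A) ≤ h := by
    refine le_trans ?_ hh
    rw [le_div_iff₀ h21, ← e]
    exact hHx
  rw [mul_one_div]
  exact div_le_div_of_nonneg_left (by norm_num) (Real.rpow_pos_of_pos hℓ0 _) h10

/-- (n4) `4/Y ≤ 4 ℓ^{-12A/5}` for `Y ≥ X/ℓ^{6A}`, `X ≥ ℓ^{16A}`. [folklore] -/
theorem numericsW_Y {ℓ A X Y : ℝ} (hℓ : 1 ≤ ℓ) (hA : 0 ≤ A) (hX : ℓ ^ (16 * A) ≤ X)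
    (hY : X / ℓ ^ (6 * A) ≤ Y) : 4 / Y ≤ 4 * (1 / ℓ ^ (12 / 5 * A)) := by
  have hℓ0 : 0 < ℓ := by linarith
  have h16 : 0 < ℓ ^ (16 * A) := Real.rpow_pos_of_pos hℓ0 _
  have h6 : 0 < ℓ ^ (6 * A) := Real.rpow_pos_of_pos hℓ0 _
  have hX0 : 0 < X := h16.trans_le hX
  have e : ℓ ^ (16 * A) = ℓ ^ (10 * A) * ℓ ^ (6 * A) := by
    rw [← Real.rpow_add hℓ0]; ring_nf
  have h10 : ℓ ^ (10 * A) ≤ Y := by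
    refine le_trans ?_ hY
    rw [le_div_iff₀ h6, ← e]
    exact hX
  have h12 : ℓ ^ (12 / 5 * A) ≤ ℓ ^ (10 * A) := Real.rpow_le_rpow_of_exponent_le hℓ (by nlinarith)
  rw [mul_one_div]
  exact div_le_div_of_nonneg_left (by norm_num) (Real.rpow_pos_of_pos hℓ0 _) (h12.trans h10)

/-- (n5) The long-window term: `2 (h/h₂)² η² Y ≤ 2 (24 C₈ 2^{71A})² h² Y ℓ^{-12A/5}` for
`h₂ = Y/ℓ^{18A}`, `η = 24 C₈ Y/(ℓ/2)^{71A}` (the exact exponent is `36A - 142A`). [folklore] -/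
theorem numericsW_eta {ℓ A C₈ h Y : ℝ} (hℓ : 1 ≤ ℓ) (hA : 0 ≤ A) (hY : 0 < Y) :
    2 * (h / (Y / (ℓ ^ (6 * A)) ^ 3)) ^ 2 * (24 * C₈ * Y / (ℓ / 2) ^ (71 * A)) ^ 2 * Y ≤
      2 * (24 * C₈ * 2 ^ (71 * A)) ^ 2 * (h ^ 2 * Y * (1 / ℓ ^ (12 / 5 * A))) := by
  have hℓ0 : 0 < ℓ := by linarith
  have e1 : (ℓ ^ (6 * A)) ^ 3 = ℓ ^ (18 * A) := by
    rw [← Real.rpow_natCast, ← Real.rpow_mul hℓ0.le]; ring_nf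
  have e2 : (ℓ / 2) ^ (71 * A) = ℓ ^ (71 * A) / 2 ^ (71 * A) := Real.div_rpow hℓ0.le (by norm_num) _
  have h18 : 0 < ℓ ^ (18 * A) := Real.rpow_pos_of_pos hℓ0 _
  have h71 : 0 < ℓ ^ (71 * A) := Real.rpow_pos_of_pos hℓ0 _
  have h12 : 0 < ℓ ^ (12 / 5 * A) := Real.rpow_pos_of_pos hℓ0 _
  have h2 : (0 : ℝ) < 2 ^ (71 * A) := Real.rpow_pos_of_pos (by norm_num) _
  -- the identity with the exact exponent `-106 A`
  have hid : 2 * (h / (Y / (ℓ ^ (6 * A)) ^ 3)) ^ 2 * (24 * C₈ * Y / (ℓ / 2) ^ (71 * A)) ^ 2 * Y =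
      2 * (24 * C₈ * 2 ^ (71 * A)) ^ 2 * (h ^ 2 * Y) * ((ℓ ^ (18 * A)) ^ 2 / (ℓ ^ (71 * A)) ^ 2) := by
    rw [e1, e2]
    field_simp
  rw [hid]
  have hpre : 0 ≤ 2 * (24 * C₈ * 2 ^ (71 * A)) ^ 2 * (h ^ 2 * Y) := by positivity
  have hcmp : (ℓ ^ (18 * A)) ^ 2 / (ℓ ^ (71 * A)) ^ 2 ≤ 1 / ℓ ^ (12 / 5 * A) := by
    rw [div_le_div_iff₀ (by positivity) h12, one_mul, ← Real.rpow_natCast, ← Real.rpow_natCast,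
      ← Real.rpow_mul hℓ0.le, ← Real.rpow_mul hℓ0.le, ← Real.rpow_add hℓ0]
    push_cast
    exact Real.rpow_le_rpow_of_exponent_le hℓ (by nlinarith)
  calc 2 * (24 * C₈ * 2 ^ (71 * A)) ^ 2 * (h ^ 2 * Y) * ((ℓ ^ (18 * A)) ^ 2 / (ℓ ^ (71 * A)) ^ 2)
      ≤ 2 * (24 * C₈ * 2 ^ (71 * A)) ^ 2 * (h ^ 2 * Y) * (1 / ℓ ^ (12 / 5 * A)) :=
        mul_le_mul_of_nonneg_left hcmp hpre
    _ = 2 * (24 * C₈ * 2 ^ (71 * A)) ^ 2 * (h ^ 2 * Y * (1 / ℓ ^ (12 / 5 * A))) := by ring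

/-! ### The weak Proposition 3.4 for the printed set -/

-- The assembly below is long but linear (filters, two piece bounds, numerics); it needs about twice
-- the default heartbeat budget, as the tree's `Lichtman2020_liouvilleMeanSquareWith_of_dirichletMeanValueWith`.
set_option maxHeartbeats 400000 in
/-- **The WEAK Proposition 3.4 for the printed typical set, from Lemma 4.5**: given `A > 5`, `δ > 0`,
`H` with `log H/log log X → ∞` and `H ≤ exp((log X)^{2/3})`, there is `C` with, eventually in `X`, for
`q ≤ (log X)^A`, `χ (mod q)`, `h ∈ [H/(log X)^{21A/5}, H]`, `Y ∈ [X/(log X)^{6A}, X]`,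
`∫_Y^{2Y} |∑_{x ≤ m ≤ x+h, m ∈ S} λ(m)χ(m)|² dx ≤ C h²Y/(log X)^{12A/5}` (`S = S(X,A,δ)` printed).
"Proof of Proposition 3.4 from Proposition 5.1" (p. 14) with `T₀ = ℓ^{6A}`, `h₂ = Y/T₀³`, `K = 71A`
(`ℓ = log X`): the long windows by Lemma 4.8 (`Lichtman2020_liouvilleCharacterSifted_holds`,
`lemma48_at_points`, `norm_longWindow_le`), the skeleton `meanSquare_le_of_pieces_trunc` (Parseval,
Lemma 4.6; mean value theorem, Lemma 4.1) fed with `dirichletMeanValue33` (`c = 33`) for `χ` and `χ⁻¹`,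
and the numerics `numericsW_*`. [cite: Lichtman2020, Proposition 3.4 (proof), p. 14] -/
theorem liouvilleMeanSquareWeak_of_primeCharacterSum (h45 : Lichtman2020_primeCharacterSum) :
    ∀ A : ℝ, 5 < A → ∀ δ : ℝ, 0 < δ → ∀ H : ℕ → ℕ,
      Tendsto (fun X : ℕ => Real.log (H X) / Real.log (Real.log X)) atTop atTop →
      (∀ᶠ X : ℕ in atTop, (H X : ℝ) ≤ Real.exp (Real.log X ^ (2 / 3 : ℝ))) →
      ∃ C : ℝ, ∀ᶠ X : ℕ in atTop, ∀ q : ℕ, 1 ≤ q → (q : ℝ) ≤ Real.log X ^ A →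
        ∀ χ : DirichletCharacter ℂ q, ∀ h : ℕ,
          (H X : ℝ) / Real.log X ^ (21 / 5 * A) ≤ h → h ≤ H X →
          ∀ Y : ℝ, (X : ℝ) / Real.log X ^ (6 * A) ≤ Y → Y ≤ X →
            ∫ x in Y..2 * Y,
                ‖∑ m ∈ (Icc ⌈x⌉₊ ⌊x + h⌋₊).filter (lichtmanTypical X A δ (H X)),
                    ((liouville m : ℤ) : ℂ) * χ (m : ZMod q)‖ ^ 2
              ≤ C * ((h : ℝ) ^ 2 * Y / Real.log X ^ (12 / 5 * A)) := by
  intro A hA δ hδ H hH hHexp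
  have hA0 : 0 < A := by linarith
  -- the printed hypothesis `ψ(X) ≤ (log X)^{2/3}` holds in the regime
  have hone := eventually_one_le_H hH
  have hll : ∀ᶠ X : ℕ in atTop, 1 ≤ Real.log (Real.log X) :=
    (Real.tendsto_log_atTop.comp tendsto_log_natCast).eventually_ge_atTop 1
  have hψ : ∀ᶠ X : ℕ in atTop,
      Real.log (H X) / Real.log (Real.log X) ≤ Real.log X ^ (2 / 3 : ℝ) := by
    filter_upwards [hHexp, hone, hll, tendsto_log_natCast.eventually_ge_atTop 1] with X hX h1 h2 h3
    have hH0 : (0 : ℝ) < H X := by exact_mod_cast h1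
    have hlogH : Real.log (H X) ≤ Real.log X ^ (2 / 3 : ℝ) := by
      have := Real.log_le_log hH0 hX
      rwa [Real.log_exp] at this
    have hr0 : 0 ≤ Real.log X ^ (2 / 3 : ℝ) := Real.rpow_nonneg (by linarith) _
    rw [div_le_iff₀ (by linarith)]
    calc Real.log (H X) ≤ Real.log X ^ (2 / 3 : ℝ) := hlogH
      _ = Real.log X ^ (2 / 3 : ℝ) * 1 := (mul_one _).symm
      _ ≤ Real.log X ^ (2 / 3 : ℝ) * Real.log (Real.log X) := mul_le_mul_of_nonneg_left h2 hr0
  obtain ⟨C₅, h5⟩ := dirichletMeanValue33 h45 33 le_rfl A hA δ hδ H hH hψ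
  obtain ⟨C₈, h8⟩ := Lichtman2020_liouvilleCharacterSifted_holds (2 * A) (71 * A) (by linarith)
    (by linarith)
  have hC₅'0 : 0 ≤ max C₅ 0 := le_max_right _ _
  have hC₈'0 : 0 ≤ max C₈ 0 := le_max_right _ _
  have hE₀1 : max (2 / 3 : ℝ) (1 - δ / 2) < 1 := max_lt (by norm_num) (by linarith)
  refine ⟨24 * 2431 ^ 2 * (4004 + 72 * max C₅ 0) + 2 * (24 * max C₈ 0 * 2 ^ (71 * A)) ^ 2, ?_⟩
  filter_upwards [h5, hHexp, eventually_rpow_log_le_H hH (33 / 5 * A), eventually_cond_a hA0,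
    eventually_cond_b hA0, eventually_cond_d hA0, eventually_cond_e hA0, eventually_cond_f hE₀1,
    tendsto_log_natCast.eventually_ge_atTop (4 * 3 + 8), eventually_ge_atTop 3]
    with X h5X hHX hH33 hGa hGb hGd hGe hGf hℓbig hX3
  intro q hq hqA χ h hh1 hh2 Y hY1 hY2
  -- the scale `ℓ = log X`
  set ℓ := Real.log X with hℓdef
  have hℓ4 : 4 ≤ ℓ := by linarith
  have hℓ1 : 1 ≤ ℓ := by linarith
  have hℓ0 : 0 < ℓ := by linarith
  have hX3' : (3 : ℝ) ≤ X := by exact_mod_cast hX3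
  have hX0 : (0 : ℝ) < X := by linarith
  have hX1 : (1 : ℝ) < X := by linarith
  have hXexp : Real.exp ℓ = X := Real.exp_log hX0
  -- `H`, `h`
  have hHx0 : (0 : ℝ) < H X := lt_of_lt_of_le (Real.rpow_pos_of_pos hℓ0 _) hH33
  have hh2r : (h : ℝ) ≤ H X := by exact_mod_cast hh2
  have hh0 : (0 : ℝ) < h := lt_of_lt_of_le (div_pos hHx0 (Real.rpow_pos_of_pos hℓ0 _)) hh1
  have hh1' : (1 : ℝ) ≤ h := by
    have : 0 < h := by exact_mod_cast hh0
    exact_mod_cast this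
  -- `Y`
  have hGa' : 6 * A * Real.log ℓ ≤ ℓ / 2 := by
    have : (0 : ℝ) ≤ Real.log 2 := Real.log_nonneg (by norm_num); linarith
  have hYℓ : ℓ / 2 ≤ Y := (half_log_le_div_rpow hXexp hℓ0 hGa').trans hY1
  have hY2' : 2 ≤ Y := by linarith
  have hY1' : 1 ≤ Y := by linarith
  have hY0 : 0 < Y := by linarith
  -- `T₀ = ℓ^{6A}`, `h₂ = Y/T₀³`, `U = Y/h`
  have hT₀1 : 1 ≤ ℓ ^ (6 * A) := Real.one_le_rpow hℓ1 (by positivity)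
  have hT₀22 : 1 ≤ ℓ ^ (22 * A) := Real.one_le_rpow hℓ1 (by positivity)
  have hT₀le : ℓ ^ (6 * A) ≤ ℓ ^ (22 * A) := Real.rpow_le_rpow_of_exponent_le hℓ1 (by nlinarith)
  have hcube : (ℓ ^ (6 * A)) ^ 3 ≤ (ℓ ^ (22 * A)) ^ 3 :=
    pow_le_pow_left₀ (by linarith) hT₀le 3
  have hhh₂ : (h : ℝ) ≤ Y / (ℓ ^ (6 * A)) ^ 3 := by
    refine (h_le_h₂ hXexp hℓ1 hh2r hHX hY1 hGb).trans ?_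
    exact div_le_div_of_nonneg_left hY0.le (by positivity) hcube
  have hh₂0 : 0 ≤ Y / (ℓ ^ (6 * A)) ^ 3 := by positivity
  have hh₂Y : Y / (ℓ ^ (6 * A)) ^ 3 ≤ Y := div_le_self hY0.le (one_le_pow₀ hT₀1)
  have hT₀U : ℓ ^ (6 * A) ≤ Y / h := hT₀le.trans (T₀_le_U hXexp hℓ1 hA0.le hh0 hh2r hHX hY1 hGb)
  have hU : Y ^ (1 / 2 : ℝ) ≤ Y / h := sqrt_le_U' hXexp hℓ1 hh0 hh2r hHX hY1 hGd
  have hQ0 : (0 : ℝ) ≤ H X / ℓ ^ (4 * A) := by positivity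
  have hℓ3 : 0 < ℓ ^ (3 * A) := Real.rpow_pos_of_pos hℓ0 _
  have hL0 : (0 : ℝ) ≤ 1 / ℓ ^ (3 * A) := by positivity
  have hη0 : 0 ≤ 24 * max C₈ 0 * Y / (ℓ / 2) ^ (71 * A) := by positivity
  -- the long windows ((5.3)), along `S = S_33`
  have h8' := lemma48_at_points (c' := 33) χ (by norm_num) hA0 hδ h8 hX1 hℓ4 hℓbig hHX hGa hGe hGf
    hq hqA hY1 hY2 hYℓ
  have hlogN : ∀ N : ℕ, Y / 2 ≤ N → (N : ℝ) ≤ 3 * Y → ℓ / 2 ≤ Real.log N := by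
    intro N hN1 hN2
    have hN1' : (X : ℝ) / (2 * Real.log X ^ (6 * A)) ≤ N := by
      have : (X : ℝ) / (2 * Real.log X ^ (6 * A)) = X / Real.log X ^ (6 * A) / 2 := by
        rw [div_div, mul_comm]
      rw [this]; linarith
    exact (log_point_bounds hX1 (by linarith) hGa hN1' (hN2.trans (by linarith))).1
  have hS₂ : ∀ x ∈ Set.Icc Y (2 * Y),
      ‖∑ m ∈ (Finset.Icc ⌈x⌉₊ ⌊x + Y / (ℓ ^ (6 * A)) ^ 3⌋₊).filter
        (lichtmanTypicalWith 33 X A δ (H X)),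
        ((liouville m : ℤ) : ℂ) * χ (m : ZMod q)‖ ≤ 24 * max C₈ 0 * Y / (ℓ / 2) ^ (71 * A) :=
    fun x hx => norm_longWindow_le χ hY2' hh₂0 hh₂Y hx hC₈'0 (by positivity) (by linarith) hlogN h8'
  -- the two Proposition-5.1 bounds at the scale `Y`
  have hY2X : Y ≤ 2 * (X : ℝ) := by linarith
  haveI : NeZero q := ⟨by omega⟩
  have hP₁ : DirichletPieceBound (lichtmanTypicalWith 33 X A δ (H X))
      (fun n => ((liouville n : ℤ) : ℂ) * χ (n : ZMod q)) Y (ℓ ^ (6 * A)) (max C₅ 0)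
      (H X / ℓ ^ (4 * A)) (1 / ℓ ^ (3 * A)) :=
    pieceBound_of_prop51 hℓ3 hY0 hY2X hQ0 fun T hT1 hT2 => h5X q hq hqA χ Y hY1 hY2X T hT1 hT2
  have hP₃ : DirichletPieceBound (lichtmanTypicalWith 33 X A δ (H X))
      (fun n => star (((liouville n : ℤ) : ℂ) * χ (n : ZMod q))) Y (ℓ ^ (6 * A)) (max C₅ 0)
      (H X / ℓ ^ (4 * A)) (1 / ℓ ^ (3 * A)) := by
    rw [star_liouville_mul_char χ]
    exact pieceBound_of_prop51 hℓ3 hY0 hY2X hQ0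
      fun T hT1 hT2 => h5X q hq hqA χ⁻¹ Y hY1 hY2X T hT1 hT2
  -- the skeleton
  have main := meanSquare_le_of_pieces_trunc (lichtmanTypicalWith 33 X A δ (H X))
    (c := fun n => ((liouville n : ℤ) : ℂ) * χ (n : ZMod q)) (norm_liouville_mul_char_le χ)
    hY1' hT₀1 hh1' hhh₂ le_rfl hη0 hC₅'0 hQ0 hL0 hT₀U hU hS₂ hP₁ hP₃
  -- pass from `S_33` to the printed set (the same set)
  have hfilt : ∀ s : Finset ℕ, s.filter (lichtmanTypical X A δ (H X)) =
      s.filter (lichtmanTypicalWith 33 X A δ (H X)) := by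
    intro s
    ext n
    simp only [Finset.mem_filter, lichtmanTypical, lichtmanTypicalWith]
  simp_rw [hfilt]
  refine main.trans ?_
  -- numerics
  have hX16 : ℓ ^ (16 * A) ≤ X := by
    refine rpow_log_le_self hXexp hℓ0 ?_
    have h1 : 0 ≤ Real.log ℓ := Real.log_nonneg hℓ1
    have h2 : 0 ≤ ℓ ^ (2 / 3 : ℝ) := Real.rpow_nonneg hℓ0.le _
    nlinarith
  have hn1 := numericsW_T₀ hℓ1 hA0.le (ℓ := ℓ)
  have hn2 := numericsW_main hℓ1 hA0.le hC₅'0 hHx0 hh1 (A := A)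
  have hn3 := numericsW_h hℓ1 hH33 hh1
  have hn4 := numericsW_Y hℓ1 hA0.le hX16 hY1
  have hn5 := numericsW_eta (C₈ := max C₈ 0) (h := (h : ℝ)) hℓ1 hA0.le hY0
  have hι : 0 < 1 / ℓ ^ (12 / 5 * A) := by positivity
  have hsum : 2000 / (ℓ ^ (6 * A)) ^ 2 + 36 * max C₅ 0 * (H X / ℓ ^ (4 * A) / h + 1) * (1 / ℓ ^ (3 * A))
      + 2000 / h + 4 / Y ≤ (4004 + 72 * max C₅ 0) * (1 / ℓ ^ (12 / 5 * A)) := by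
    linarith
  have hpre : 0 ≤ 24 * 2431 ^ 2 * (h : ℝ) ^ 2 * Y := by positivity
  have h1 := mul_le_mul_of_nonneg_left hsum hpre
  have e : (h : ℝ) ^ 2 * Y / ℓ ^ (12 / 5 * A) = (h : ℝ) ^ 2 * Y * (1 / ℓ ^ (12 / 5 * A)) := by
    rw [mul_one_div]
  rw [e]
  linarith [h1, hn5]

end Lichtman2020

/-! ### The discharge of `Lichtman2020_keyFourierEstimateLiouville'` up to Lemma 4.5 / Khale -/

open Lichtman2020 in
/-- **Proposition 2.3 (regime `H ≤ exp((log X)^{2/3})`, printed typical set) from Lemma 4.5**: the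
named fact `Lichtman2020_keyFourierEstimateLiouville'` follows from the named fact
`Lichtman2020_primeCharacterSum` (Lemma 4.5, the Vinogradov–Korobov bound for prime character sums),
every other step of §§3–5 being proved in the tree: minor arcs (Proposition 3.1,
`Lichtman2020_minorArcEstimate_holds`), major arcs by pieces from the weak Proposition 3.4
(`Lichtman2020_keyFourierEstimateLiouville'_of_meanSquareWeak`), the weak Proposition 3.4 from
Proposition 5.1 at the printed `P₁` with saving `(log X)^{-3A}`
(`liouvilleMeanSquareWeak_of_primeCharacterSum`, `dirichletMeanValue33`).
[cite: Lichtman2020, Proposition 2.3] -/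
theorem Lichtman2020_keyFourierEstimateLiouville'_of_primeCharacterSum
    (h45 : Lichtman2020_primeCharacterSum) : Lichtman2020_keyFourierEstimateLiouville' :=
  Lichtman2020_keyFourierEstimateLiouville'_of_meanSquareWeak
    (liouvilleMeanSquareWeak_of_primeCharacterSum h45)

open Lichtman2020 Literature.NumberTheory.LFunctions in
/-- **Proposition 2.3 (regime, printed typical set) from Khale's explicit Vinogradov–Korobov zero-free
region for Dirichlet `L`-functions** — the only printed theorem of the deduction not proved in the
tree (Lemma 4.5 ⇐ Khale: `Lichtman2020.PrimeCharSum.Lichtman2020_primeCharacterSum_of_khale`).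
[cite: Lichtman2020, Proposition 2.3] [cite: Khale2024, Theorem 1.1 (1.2)] -/
theorem Lichtman2020_keyFourierEstimateLiouville'_of_khale (hK : Khale2024_zeroFreeRegion) :
    Lichtman2020_keyFourierEstimateLiouville' :=
  Lichtman2020_keyFourierEstimateLiouville'_of_primeCharacterSum
    (Lichtman2020.PrimeCharSum.Lichtman2020_primeCharacterSum_of_khale hK)

open Lichtman2020 in
/-- **Theorem 2.2 for the printed typical set (regime `H ≤ exp((log X)^{2/3})`,
`Lichtman2020_keyFourierEstimate`) from Lemma 4.5**, through the tree's
`Lichtman2020_keyFourierEstimate_of_liouville'`. [cite: Lichtman2020, Theorem 2.2] -/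
theorem Lichtman2020_keyFourierEstimate_of_primeCharacterSum'
    (h45 : Lichtman2020_primeCharacterSum) : Lichtman2020_keyFourierEstimate :=
  Lichtman2020_keyFourierEstimate_of_liouville'
    (Lichtman2020_keyFourierEstimateLiouville'_of_primeCharacterSum h45)

open Lichtman2020 Literature.NumberTheory.LFunctions in
/-- **Theorem 2.2 for the printed typical set from Khale's zero-free region.**
[cite: Lichtman2020, Theorem 2.2] [cite: Khale2024, Theorem 1.1 (1.2)] -/
theorem Lichtman2020_keyFourierEstimate_of_khale' (hK : Khale2024_zeroFreeRegion) :
    Lichtman2020_keyFourierEstimate :=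
  Lichtman2020_keyFourierEstimate_of_liouville' (Lichtman2020_keyFourierEstimateLiouville'_of_khale hK)

/-! ### The same from any Vinogradov–Korobov region (the inexplicit interface) -/

open Lichtman2020 Literature.NumberTheory.LFunctions in
/-- **Proposition 2.3 (regime, printed typical set) from ANY Vinogradov–Korobov zero-free region for
Dirichlet `L`-functions** — `HasVKZeroFreeRegion c T₀` with `c > 0` and any starting height `T₀`, the
inexplicit interface of `VinogradovKorobovDirichlet.lean` (Khale's Theorem 1.1 is the case
`c = 1/61.5`, `T₀ = 10`; the inexplicit region is Montgomery, *Ten lectures*, p. 176), through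
`Lichtman2020.PrimeCharSum.Lichtman2020_primeCharacterSum_of_vk`.  So a proof of the region by
Vinogradov's method with unspecified constants discharges the fact.
[cite: Lichtman2020, Proposition 2.3] -/
theorem Lichtman2020_keyFourierEstimateLiouville'_of_vk {cVK TVK : ℝ} (hcVK : 0 < cVK)
    (hVK : HasVKZeroFreeRegion cVK TVK) : Lichtman2020_keyFourierEstimateLiouville' :=
  Lichtman2020_keyFourierEstimateLiouville'_of_primeCharacterSum
    (Lichtman2020.PrimeCharSum.Lichtman2020_primeCharacterSum_of_vk hcVK hVK)

open Lichtman2020 Literature.NumberTheory.LFunctions in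
/-- **Theorem 2.2 for the printed typical set from any Vinogradov–Korobov region**
(`HasVKZeroFreeRegion c T₀`, `c > 0`). [cite: Lichtman2020, Theorem 2.2] -/
theorem Lichtman2020_keyFourierEstimate_of_vk' {cVK TVK : ℝ} (hcVK : 0 < cVK)
    (hVK : HasVKZeroFreeRegion cVK TVK) : Lichtman2020_keyFourierEstimate :=
  Lichtman2020_keyFourierEstimate_of_liouville'
    (Lichtman2020_keyFourierEstimateLiouville'_of_vk hcVK hVK)

end Literature.NumberTheory.Sieve
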